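import Literature.Analysis.FluidPDE.SereginSverakBlowup
import Literature.Analysis.FluidPDE.SereginSverakBlowupSelection
import Literature.Analysis.FluidPDE.HeatDuhamelBack
import Literature.Analysis.FluidPDE.DistributionalToWeak
import HarnessLib

/-!
# Seregin–Šverák 2009, §4: passing to the limit in the distributional identities (elementary lemmas)

Support file for the compactness step (iv) of G. Seregin, V. Šverák, *On Type I singularities
of the local axi-symmetric solutions of the Navier–Stokes equations*, Comm. PDE 34 (2009) =
arXiv:0804.1803, §4 (arXiv p. 11): "`u^k → u` in `C^{1/4}(Q̄(a/2))`. This means that the pair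
`u` and `p` obeys the Navier–Stokes system … So, the function `u` is the so-called bounded
ancient solution to the Navier–Stokes system". In the rendering of
`SereginSverak2009.BlowupCompactness` the limit is to be a bounded weak solution on
`ℝ³ × ]-∞, 0[` in the class of Koch–Nadirashvili–Seregin–Šverák (accepted
`IsBoundedWeakNSSolutionOn (Iio 0)`: divergence-free slices for a.e. time and the identity
against divergence-free space–time test fields — no pressure), so only the velocities have to
converge, and locally uniform convergence of fields bounded by `1` is more than enough. This file
proves, in full, for the parabolic cylinders `Q(N) = parCyl 0 N`:

* the Navier–Stokes identity of a distributional solution `(u^k, p^k)` on `Q(R_k)` tested with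
  a divergence-free field supported in `Q(N) ⊆ Q(R_k)` — the pressure term drops and the
  identity may be written with any representative `V_k = u^k` a.e. and over `Q(N)`
  (`setIntegral_nsIntegrand_eq_zero`), and likewise the divergence identity
  (`setIntegral_inner_gradient_eq_zero`);
* dominated convergence under uniform convergence `V_j → W` on `Q(N)` of fields bounded by `1`
  (`tendsto_setIntegral_nsIntegrand`, `tendsto_setIntegral_inner_gradient`);
* Fubini: the identity over `Q(N)` is the iterated identity over the slab `]-∞, 0[ × ℝ³` of
  `IsBoundedWeakNSSolutionOn` (`setIntegral_nsIntegrand_eq_integral_Iio`,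
  `setIntegral_inner_gradient_eq_integral`);
* from the space–time divergence identity to weakly divergence-free slices for a.e. `t < 0`
  (`ae_isWeaklyDivFree_of_forall_spaceTimeTest`: tests `η(t)θ(x)`, Fubini, and the fundamental
  lemma of the calculus of variations in `t`, as in `DistributionalToWeak`).

## References

* G. Seregin, V. Šverák, Comm. PDE 34 (2009), arXiv:0804.1803, §4 p. 11. [`SereginSverak2009`]
* G. Koch, N. Nadirashvili, G. Seregin, V. Šverák, Acta Math. 203 (2009), §4 (ii) (the class of
  bounded weak solutions). [`KochNadirashviliSereginSverak2009`]
-/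

noncomputable section

open MeasureTheory Set Function Filter Topology TopologicalSpace Metric
open scoped Laplacian InnerProductSpace RealInnerProductSpace NNReal ENNReal

namespace Literature.Analysis.FluidPDE

namespace SereginSverak2009

/-! ### Supports and continuity of the tested integrands -/

/-- Off the support of a space–time field, the point is off the support of the slice. [folklore] -/
theorem notMem_tsupport_slice_of_notMem {X F : Type*} [TopologicalSpace X] [Zero F]
    {ψ : ℝ → X → F} {t : ℝ} {x : X} (h : (t, x) ∉ tsupport (uncurry ψ)) :
    x ∉ tsupport (ψ t) := by
  have h0 : uncurry ψ =ᶠ[𝓝 (t, x)] 0 := notMem_tsupport_iff_eventuallyEq.1 h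
  have hc : Continuous fun y : X => (t, y) := continuous_const.prodMk continuous_id
  have h1 : ψ t =ᶠ[𝓝 x] 0 := (hc.tendsto x).eventually h0
  exact notMem_tsupport_iff_eventuallyEq.2 h1

/-- Off the support of a space–time test field its slice Laplacian vanishes. [folklore] -/
theorem laplacian_slice_eq_zero_of_notMem
    {ψ : ℝ → EuclideanSpace ℝ (Fin 3) → EuclideanSpace ℝ (Fin 3)} {t : ℝ}
    {x : EuclideanSpace ℝ (Fin 3)} (h : (t, x) ∉ tsupport (uncurry ψ)) : Δ (ψ t) x = 0 :=
  laplacian_eq_zero_of_notMem_tsupport (notMem_tsupport_slice_of_notMem h)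

/-- Off the support of a scalar space–time test field its slice gradient vanishes. [folklore] -/
theorem gradient_slice_eq_zero_of_notMem {θ : ℝ → EuclideanSpace ℝ (Fin 3) → ℝ} {t : ℝ}
    {x : EuclideanSpace ℝ (Fin 3)} (h : (t, x) ∉ tsupport (uncurry θ)) : gradient (θ t) x = 0 :=
  gradient_eq_zero_of_notMem_tsupport (notMem_tsupport_slice_of_notMem h)

/-- The Navier–Stokes integrand `⟪V, ∂ₜψ⟫ + ⟪V, (V·∇)ψ⟫ + ⟪V, Δψ⟫` vanishes off the support of
the test field. [folklore] -/
theorem nsIntegrand_eq_zero_of_notMem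
    {ψ : ℝ → EuclideanSpace ℝ (Fin 3) → EuclideanSpace ℝ (Fin 3)}
    (V : ℝ × EuclideanSpace ℝ (Fin 3) → EuclideanSpace ℝ (Fin 3))
    {z : ℝ × EuclideanSpace ℝ (Fin 3)} (hz : z ∉ tsupport (uncurry ψ)) :
    ⟪V z, timeDeriv ψ z.1 z.2⟫ + ⟪V z, fderiv ℝ (ψ z.1) z.2 (V z)⟫ + ⟪V z, Δ (ψ z.1) z.2⟫ = 0 := by
  have hz' : (z.1, z.2) ∉ tsupport (uncurry ψ) := hz
  rw [IsSpaceTimeTestOn.timeDeriv_eq_zero_of_notMem hz',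
    IsSpaceTimeTestOn.fderiv_slice_eq_zero_of_notMem hz', laplacian_slice_eq_zero_of_notMem hz']
  simp

/-- The divergence integrand `⟪V, ∇θ⟫` vanishes off the support of the test function. [folklore] -/
theorem inner_gradient_eq_zero_of_notMem {θ : ℝ → EuclideanSpace ℝ (Fin 3) → ℝ}
    (V : ℝ × EuclideanSpace ℝ (Fin 3) → EuclideanSpace ℝ (Fin 3))
    {z : ℝ × EuclideanSpace ℝ (Fin 3)} (hz : z ∉ tsupport (uncurry θ)) :
    ⟪V z, gradient (θ z.1) z.2⟫ = 0 := by
  have hz' : (z.1, z.2) ∉ tsupport (uncurry θ) := hz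
  rw [gradient_slice_eq_zero_of_notMem hz', inner_zero_right]

/-- The Navier–Stokes integrand is continuous wherever `V` is. [folklore] -/
theorem continuousOn_nsIntegrand
    {ψ : ℝ → EuclideanSpace ℝ (Fin 3) → EuclideanSpace ℝ (Fin 3)}
    (hψ : IsSpaceTimeTestOn (⊤ : Opens (ℝ × EuclideanSpace ℝ (Fin 3))) ψ)
    {V : ℝ × EuclideanSpace ℝ (Fin 3) → EuclideanSpace ℝ (Fin 3)}
    {S : Set (ℝ × EuclideanSpace ℝ (Fin 3))} (hV : ContinuousOn V S) :
    ContinuousOn (fun z => ⟪V z, timeDeriv ψ z.1 z.2⟫ + ⟪V z, fderiv ℝ (ψ z.1) z.2 (V z)⟫ +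
      ⟪V z, Δ (ψ z.1) z.2⟫) S := by
  have c1 : Continuous (fun z : ℝ × EuclideanSpace ℝ (Fin 3) => timeDeriv ψ z.1 z.2) :=
    hψ.timeDeriv_top.continuous_uncurry
  have c2 : Continuous (fun z : ℝ × EuclideanSpace ℝ (Fin 3) => fderiv ℝ (ψ z.1) z.2) :=
    hψ.fderiv_top.continuous_uncurry
  have c3 : Continuous (fun z : ℝ × EuclideanSpace ℝ (Fin 3) => Δ (ψ z.1) z.2) :=
    hψ.laplacian_top.continuous_uncurry
  exact ((hV.inner c1.continuousOn).add (hV.inner (c2.continuousOn.clm_apply hV))).add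
    (hV.inner c3.continuousOn)

/-- The divergence integrand is continuous wherever `V` is. [folklore] -/
theorem continuousOn_inner_gradient {θ : ℝ → EuclideanSpace ℝ (Fin 3) → ℝ}
    (hθ : IsSpaceTimeTestOn (⊤ : Opens (ℝ × EuclideanSpace ℝ (Fin 3))) θ)
    {V : ℝ × EuclideanSpace ℝ (Fin 3) → EuclideanSpace ℝ (Fin 3)}
    {S : Set (ℝ × EuclideanSpace ℝ (Fin 3))} (hV : ContinuousOn V S) :
    ContinuousOn (fun z => ⟪V z, gradient (θ z.1) z.2⟫) S := by
  have c2 : Continuous (fun z : ℝ × EuclideanSpace ℝ (Fin 3) => fderiv ℝ (θ z.1) z.2) :=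
    hθ.fderiv_top.continuous_uncurry
  have heq : (fun z : ℝ × EuclideanSpace ℝ (Fin 3) => gradient (θ z.1) z.2) = fun z =>
      (InnerProductSpace.toDual ℝ (EuclideanSpace ℝ (Fin 3))).symm (fderiv ℝ (θ z.1) z.2) := rfl
  have c3 : Continuous (fun z : ℝ × EuclideanSpace ℝ (Fin 3) => gradient (θ z.1) z.2) := by
    rw [heq]
    exact (InnerProductSpace.toDual ℝ (EuclideanSpace ℝ (Fin 3))).symm.continuous.comp c2
  exact hV.inner c3.continuousOn

/-- A function continuous on an open set `O` and vanishing off a closed set `K ⊆ O` is continuous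
everywhere. [folklore] -/
theorem continuous_of_continuousOn_of_eq_zero {X Y : Type*} [TopologicalSpace X]
    [TopologicalSpace Y] [Zero Y] {g : X → Y} {O : Set X} (hO : IsOpen O) (hg : ContinuousOn g O)
    {K : Set X} (hK : IsClosed K) (hKO : K ⊆ O) (h0 : ∀ z ∉ K, g z = 0) : Continuous g := by
  rw [continuous_iff_continuousAt]
  intro z
  by_cases hz : z ∈ O
  · exact hg.continuousAt (hO.mem_nhds hz)
  · have hzK : z ∉ K := fun h => hz (hKO h)
    have hev : g =ᶠ[𝓝 z] fun _ => 0 := by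
      filter_upwards [hK.isOpen_compl.mem_nhds hzK] with w hw
      exact h0 w hw
    exact continuousAt_const.congr_of_eventuallyEq hev

/-- The cylinders `Q(N)` have finite volume. [folklore] -/
theorem volume_parCyl_lt_top (N : ℝ) :
    volume (parCyl (0 : ℝ × EuclideanSpace ℝ (Fin 3)) N) < ∞ := by
  have hsub : parCyl (0 : ℝ × EuclideanSpace ℝ (Fin 3)) N ⊆
      Ioo (-N ^ 2) 0 ×ˢ closedBall (0 : EuclideanSpace ℝ (Fin 3)) (N + N) := by
    intro z hz
    rw [mem_parCyl_zero] at hz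
    refine ⟨hz.1, mem_closedBall_zero_iff.2 ?_⟩
    exact (norm_le_cylRadius_add_abs z.2).trans (by linarith [hz.2.1, hz.2.2])
  refine lt_of_le_of_lt (measure_mono hsub) ?_
  rw [Measure.volume_eq_prod, Measure.prod_prod]
  exact ENNReal.mul_lt_top measure_Ioo_lt_top measure_closedBall_lt_top

/-- `Q(N)` lies in the open half-space `{s < 0} × ℝ³`. [folklore] -/
theorem parCyl_subset_Iio_prod (N : ℝ) :
    parCyl (0 : ℝ × EuclideanSpace ℝ (Fin 3)) N ⊆ Iio 0 ×ˢ univ := fun _ hz =>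
  ⟨(mem_parCyl_zero.1 hz).1.2, mem_univ _⟩

/-! ### The tested identities for one term of the sequence -/

/-- **The Navier–Stokes identity on `Q(N)` for a representative.** If `(u, p)` solves
Navier–Stokes (`ν = 1`, no force) in the sense of distributions in `Q(R)`, `V = u` a.e. on
`Q(R)`, and `ψ` is a space–time test field with divergence-free slices supported in
`Q(N) ⊆ Q(R)`, then `∫_{Q(N)} (⟪V, ∂ₜψ⟫ + ⟪V, (V·∇)ψ⟫ + ⟪V, Δψ⟫) = 0` (the pressure term
`∫ p div ψ` vanishes). [cite: SereginSverak2009, §4 ("These functions satisfy the Navier-Stokes equations in Q(M_k)", arXiv p. 11)] -/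
theorem setIntegral_nsIntegrand_eq_zero {R N : ℝ} (hN : 0 ≤ N) (hNR : N ≤ R)
    {U : ℝ → EuclideanSpace ℝ (Fin 3) → EuclideanSpace ℝ (Fin 3)}
    {P : ℝ → EuclideanSpace ℝ (Fin 3) → ℝ}
    (hNS : IsDistributionalNSSolutionOn (parCylOpens 0 R) 1 0 U P)
    {V : ℝ × EuclideanSpace ℝ (Fin 3) → EuclideanSpace ℝ (Fin 3)}
    (hVU : V =ᵐ[volume.restrict (parCyl 0 R)] uncurry U)
    {ψ : ℝ → EuclideanSpace ℝ (Fin 3) → EuclideanSpace ℝ (Fin 3)}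
    (hψ : IsSpaceTimeTestOn (⊤ : Opens (ℝ × EuclideanSpace ℝ (Fin 3))) ψ)
    (hsupp : tsupport (uncurry ψ) ⊆ parCyl 0 N) (hdiv : ∀ t, VectorCalculus.IsDivFree (ψ t)) :
    ∫ z in parCyl 0 N, (⟪V z, timeDeriv ψ z.1 z.2⟫ + ⟪V z, fderiv ℝ (ψ z.1) z.2 (V z)⟫ +
      ⟪V z, Δ (ψ z.1) z.2⟫) = 0 := by
  have hsub : parCyl (0 : ℝ × EuclideanSpace ℝ (Fin 3)) N ⊆ parCyl 0 R := parCyl_mono 0 hN hNR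
  have hψQ : IsSpaceTimeTestOn (parCylOpens 0 R) ψ :=
    ⟨hψ.contDiff, hψ.hasCompactSupport, by simpa only [coe_parCylOpens] using hsupp.trans hsub⟩
  have key := hNS.2.2.2.2 ψ hψQ
  rw [coe_parCylOpens] at key
  -- the printed integrand: no force, and the pressure term drops since `div ψ = 0`
  have key' : ∫ z in parCyl 0 R, (⟪U z.1 z.2, timeDeriv ψ z.1 z.2⟫ +
      ⟪U z.1 z.2, fderiv ℝ (ψ z.1) z.2 (U z.1 z.2)⟫ + ⟪U z.1 z.2, Δ (ψ z.1) z.2⟫) = 0 := by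
    refine (setIntegral_congr_fun (isOpen_parCyl 0 R).measurableSet fun z _ => ?_).trans key
    have hd : VectorCalculus.divergence (ψ z.1) z.2 = 0 := hdiv z.1 z.2
    simp only [convect_apply, one_mul, hd, mul_zero, add_zero, Pi.zero_apply, inner_zero_left]
  -- the representative
  have key'' : ∫ z in parCyl 0 R, (⟪V z, timeDeriv ψ z.1 z.2⟫ + ⟪V z, fderiv ℝ (ψ z.1) z.2 (V z)⟫ +
      ⟪V z, Δ (ψ z.1) z.2⟫) = 0 := by
    rw [← key']
    refine integral_congr_ae ?_
    filter_upwards [hVU] with z hz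
    rw [hz]
    rfl
  -- the integrand is supported in `Q(N)`
  have h3 := setIntegral_eq_of_subset_of_forall_sdiff_eq_zero (μ := volume)
    (f := fun z => ⟪V z, timeDeriv ψ z.1 z.2⟫ + ⟪V z, fderiv ℝ (ψ z.1) z.2 (V z)⟫ +
      ⟪V z, Δ (ψ z.1) z.2⟫) (isOpen_parCyl 0 R).measurableSet hsub
    fun z hz => nsIntegrand_eq_zero_of_notMem V fun h => hz.2 (hsupp h)
  rw [← h3]
  exact key''

/-- **The divergence identity on `Q(N)` for a representative.** If `(u, p)` solves Navier–Stokes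
in the sense of distributions in `Q(R)`, `V = u` a.e. on `Q(R)`, and `θ` is a scalar space–time
test supported in `Q(N) ⊆ Q(R)`, then `∫_{Q(N)} ⟪V, ∇θ⟫ = 0`.
[cite: SereginSverak2009, §4 (arXiv p. 11)] -/
theorem setIntegral_inner_gradient_eq_zero {R N : ℝ} (hN : 0 ≤ N) (hNR : N ≤ R)
    {U : ℝ → EuclideanSpace ℝ (Fin 3) → EuclideanSpace ℝ (Fin 3)}
    {P : ℝ → EuclideanSpace ℝ (Fin 3) → ℝ}
    (hNS : IsDistributionalNSSolutionOn (parCylOpens 0 R) 1 0 U P)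
    {V : ℝ × EuclideanSpace ℝ (Fin 3) → EuclideanSpace ℝ (Fin 3)}
    (hVU : V =ᵐ[volume.restrict (parCyl 0 R)] uncurry U)
    {θ : ℝ → EuclideanSpace ℝ (Fin 3) → ℝ}
    (hθ : IsSpaceTimeTestOn (⊤ : Opens (ℝ × EuclideanSpace ℝ (Fin 3))) θ)
    (hsupp : tsupport (uncurry θ) ⊆ parCyl 0 N) :
    ∫ z in parCyl 0 N, ⟪V z, gradient (θ z.1) z.2⟫ = 0 := by
  have hsub : parCyl (0 : ℝ × EuclideanSpace ℝ (Fin 3)) N ⊆ parCyl 0 R := parCyl_mono 0 hN hNR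
  have hθQ : IsSpaceTimeTestOn (parCylOpens 0 R) θ :=
    ⟨hθ.contDiff, hθ.hasCompactSupport, by simpa only [coe_parCylOpens] using hsupp.trans hsub⟩
  have key := hNS.2.2.2.1 θ hθQ
  rw [coe_parCylOpens] at key
  have key'' : ∫ z in parCyl 0 R, ⟪V z, gradient (θ z.1) z.2⟫ = 0 := by
    rw [← key]
    refine integral_congr_ae ?_
    filter_upwards [hVU] with z hz
    rw [hz]
    rfl
  have h3 := setIntegral_eq_of_subset_of_forall_sdiff_eq_zero (μ := volume)
    (f := fun z => ⟪V z, gradient (θ z.1) z.2⟫) (isOpen_parCyl 0 R).measurableSet hsub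
    fun z hz => inner_gradient_eq_zero_of_notMem V fun h => hz.2 (hsupp h)
  rw [← h3]
  exact key''

/-! ### Dominated convergence under uniform convergence on `Q(N)` -/

/-- **Limit of the Navier–Stokes identities.** If `V_j → W` uniformly on `Q(N)`, the `V_j` being
(for all large `j`) continuous and bounded by `1` there, then the tested Navier–Stokes integrals over `Q(N)`
converge (dominated convergence with a constant bound on a set of finite volume; the quadratic
term converges pointwise as a product). [cite: SereginSverak2009, §4 ("u^k → u in C^{1/4}(Q̄(a/2)). This means that the pair u and p obeys the Navier-Stokes system", arXiv p. 11)] -/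
theorem tendsto_setIntegral_nsIntegrand {N : ℝ}
    {Vj : ℕ → ℝ × EuclideanSpace ℝ (Fin 3) → EuclideanSpace ℝ (Fin 3)}
    {W : ℝ × EuclideanSpace ℝ (Fin 3) → EuclideanSpace ℝ (Fin 3)}
    (hunif : TendstoUniformlyOn Vj W atTop (parCyl 0 N))
    (hcont : ∀ᶠ j in atTop, ContinuousOn (Vj j) (parCyl 0 N))
    (hb : ∀ᶠ j in atTop, ∀ z ∈ parCyl 0 N, ‖Vj j z‖ ≤ 1)
    {ψ : ℝ → EuclideanSpace ℝ (Fin 3) → EuclideanSpace ℝ (Fin 3)}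
    (hψ : IsSpaceTimeTestOn (⊤ : Opens (ℝ × EuclideanSpace ℝ (Fin 3))) ψ) :
    Tendsto (fun j => ∫ z in parCyl 0 N, (⟪Vj j z, timeDeriv ψ z.1 z.2⟫ +
      ⟪Vj j z, fderiv ℝ (ψ z.1) z.2 (Vj j z)⟫ + ⟪Vj j z, Δ (ψ z.1) z.2⟫)) atTop
      (𝓝 (∫ z in parCyl 0 N, (⟪W z, timeDeriv ψ z.1 z.2⟫ +
        ⟪W z, fderiv ℝ (ψ z.1) z.2 (W z)⟫ + ⟪W z, Δ (ψ z.1) z.2⟫))) := by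
  obtain ⟨M₁, -, hM₁⟩ := hψ.timeDeriv_top.exists_norm_le
  obtain ⟨M₂, hM₂0, hM₂⟩ := hψ.fderiv_top.exists_norm_le
  obtain ⟨M₃, -, hM₃⟩ := hψ.laplacian_top.exists_norm_le
  haveI : IsFiniteMeasure (volume.restrict (parCyl (0 : ℝ × EuclideanSpace ℝ (Fin 3)) N)) :=
    ⟨by rw [Measure.restrict_apply_univ]; exact volume_parCyl_lt_top N⟩
  have hmeas : MeasurableSet (parCyl (0 : ℝ × EuclideanSpace ℝ (Fin 3)) N) :=
    (isOpen_parCyl 0 N).measurableSet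
  refine tendsto_integral_filter_of_dominated_convergence (fun _ => M₁ + M₂ + M₃)
    (hcont.mono fun j hj => (continuousOn_nsIntegrand hψ hj).aestronglyMeasurable hmeas)
    (hb.mono fun j hj => ?_) (integrable_const _) ?_
  · filter_upwards [ae_restrict_mem hmeas] with z hz
    have hv : ‖Vj j z‖ ≤ 1 := hj z hz
    have h1 : ‖⟪Vj j z, timeDeriv ψ z.1 z.2⟫‖ ≤ M₁ :=
      (norm_inner_le_norm _ _).trans ((mul_le_mul hv (hM₁ z.1 z.2) (norm_nonneg _)
        zero_le_one).trans_eq (one_mul _))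
    have h2 : ‖⟪Vj j z, fderiv ℝ (ψ z.1) z.2 (Vj j z)⟫‖ ≤ M₂ := by
      have hA : ‖fderiv ℝ (ψ z.1) z.2 (Vj j z)‖ ≤ M₂ :=
        ((fderiv ℝ (ψ z.1) z.2).le_opNorm _).trans ((mul_le_mul (hM₂ z.1 z.2) hv (norm_nonneg _)
          hM₂0).trans_eq (mul_one _))
      exact (norm_inner_le_norm _ _).trans ((mul_le_mul hv hA (norm_nonneg _)
        zero_le_one).trans_eq (one_mul _))
    have h3 : ‖⟪Vj j z, Δ (ψ z.1) z.2⟫‖ ≤ M₃ :=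
      (norm_inner_le_norm _ _).trans ((mul_le_mul hv (hM₃ z.1 z.2) (norm_nonneg _)
        zero_le_one).trans_eq (one_mul _))
    exact (norm_add₃_le).trans (add_le_add_three h1 h2 h3)
  · filter_upwards [ae_restrict_mem hmeas] with z hz
    have hv : Tendsto (fun j => Vj j z) atTop (𝓝 (W z)) := hunif.tendsto_at hz
    have hA : Tendsto (fun j => fderiv ℝ (ψ z.1) z.2 (Vj j z)) atTop
        (𝓝 (fderiv ℝ (ψ z.1) z.2 (W z))) :=
      ((fderiv ℝ (ψ z.1) z.2).continuous.tendsto _).comp hv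
    exact ((hv.inner tendsto_const_nhds).add (hv.inner hA)).add (hv.inner tendsto_const_nhds)

/-- **Limit of the divergence identities** under uniform convergence on `Q(N)`.
[cite: SereginSverak2009, §4 (arXiv p. 11)] -/
theorem tendsto_setIntegral_inner_gradient {N : ℝ}
    {Vj : ℕ → ℝ × EuclideanSpace ℝ (Fin 3) → EuclideanSpace ℝ (Fin 3)}
    {W : ℝ × EuclideanSpace ℝ (Fin 3) → EuclideanSpace ℝ (Fin 3)}
    (hunif : TendstoUniformlyOn Vj W atTop (parCyl 0 N))
    (hcont : ∀ᶠ j in atTop, ContinuousOn (Vj j) (parCyl 0 N))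
    (hb : ∀ᶠ j in atTop, ∀ z ∈ parCyl 0 N, ‖Vj j z‖ ≤ 1)
    {θ : ℝ → EuclideanSpace ℝ (Fin 3) → ℝ}
    (hθ : IsSpaceTimeTestOn (⊤ : Opens (ℝ × EuclideanSpace ℝ (Fin 3))) θ) :
    Tendsto (fun j => ∫ z in parCyl 0 N, ⟪Vj j z, gradient (θ z.1) z.2⟫) atTop
      (𝓝 (∫ z in parCyl 0 N, ⟪W z, gradient (θ z.1) z.2⟫)) := by
  obtain ⟨M, -, hM⟩ := hθ.fderiv_top.exists_norm_le
  haveI : IsFiniteMeasure (volume.restrict (parCyl (0 : ℝ × EuclideanSpace ℝ (Fin 3)) N)) :=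
    ⟨by rw [Measure.restrict_apply_univ]; exact volume_parCyl_lt_top N⟩
  have hmeas : MeasurableSet (parCyl (0 : ℝ × EuclideanSpace ℝ (Fin 3)) N) :=
    (isOpen_parCyl 0 N).measurableSet
  have hgrad : ∀ z : ℝ × EuclideanSpace ℝ (Fin 3), ‖gradient (θ z.1) z.2‖ ≤ M := fun z => by
    rw [gradient, LinearIsometryEquiv.norm_map]
    exact hM z.1 z.2
  refine tendsto_integral_filter_of_dominated_convergence (fun _ => M)
    (hcont.mono fun j hj => (continuousOn_inner_gradient hθ hj).aestronglyMeasurable hmeas)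
    (hb.mono fun j hj => ?_) (integrable_const _) ?_
  · filter_upwards [ae_restrict_mem hmeas] with z hz
    exact (norm_inner_le_norm _ _).trans ((mul_le_mul (hj z hz) (hgrad z) (norm_nonneg _)
      zero_le_one).trans_eq (one_mul _))
  · filter_upwards [ae_restrict_mem hmeas] with z hz
    exact (hunif.tendsto_at hz).inner tendsto_const_nhds

/-! ### From `Q(N)` to the slab `]-∞, 0[ × ℝ³` -/

/-- **Fubini for the limit identity.** For `W` continuous on the open half-space and a test field
`ψ` supported in `Q(N)`, the Navier–Stokes integral over `Q(N)` equals the iterated integral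
`∫_{t<0} ∫ (⟪W, ∂ₜψ⟫ + ⟪W, (W·∇)ψ⟫ + ⟪W, Δψ⟫) dx dt` of `IsBoundedWeakNSSolutionOn (Iio 0)`.
[folklore] -/
theorem setIntegral_nsIntegrand_eq_integral_Iio {N : ℝ}
    {W : ℝ × EuclideanSpace ℝ (Fin 3) → EuclideanSpace ℝ (Fin 3)}
    (hW : ContinuousOn W (Iio 0 ×ˢ univ))
    {ψ : ℝ → EuclideanSpace ℝ (Fin 3) → EuclideanSpace ℝ (Fin 3)}
    (hψ : IsSpaceTimeTestOn (⊤ : Opens (ℝ × EuclideanSpace ℝ (Fin 3))) ψ)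
    (hsupp : tsupport (uncurry ψ) ⊆ parCyl 0 N) :
    ∫ z in parCyl 0 N, (⟪W z, timeDeriv ψ z.1 z.2⟫ + ⟪W z, fderiv ℝ (ψ z.1) z.2 (W z)⟫ +
      ⟪W z, Δ (ψ z.1) z.2⟫) =
      ∫ t in Iio (0 : ℝ), ∫ x, (⟪W (t, x), timeDeriv ψ t x⟫ +
        ⟪W (t, x), fderiv ℝ (ψ t) x (W (t, x))⟫ + ⟪W (t, x), Δ (ψ t) x⟫) := by
  set G : ℝ × EuclideanSpace ℝ (Fin 3) → ℝ := fun z => ⟪W z, timeDeriv ψ z.1 z.2⟫ +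
    ⟪W z, fderiv ℝ (ψ z.1) z.2 (W z)⟫ + ⟪W z, Δ (ψ z.1) z.2⟫ with hG
  have hQ := parCyl_subset_Iio_prod N
  have h0 : ∀ z ∉ tsupport (uncurry ψ), G z = 0 := fun z hz => nsIntegrand_eq_zero_of_notMem W hz
  have hGc : Continuous G :=
    continuous_of_continuousOn_of_eq_zero (isOpen_Iio.prod isOpen_univ)
      (continuousOn_nsIntegrand hψ hW) (isClosed_tsupport _) (hsupp.trans hQ) h0
  have hGK : HasCompactSupport G := HasCompactSupport.intro hψ.hasCompactSupport h0
  have hGi : Integrable G ((volume : Measure ℝ).prod (volume : Measure (EuclideanSpace ℝ (Fin 3)))) :=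
    hGc.integrable_of_hasCompactSupport hGK
  have h1 : ∫ z in parCyl 0 N, G z = ∫ z, G z :=
    setIntegral_eq_integral_of_forall_compl_eq_zero fun z hz => h0 z fun h => hz (hsupp h)
  have h2 : ∫ z, G z = ∫ t, ∫ x, G (t, x) := by
    rw [Measure.volume_eq_prod]
    exact integral_prod G hGi
  have h3 : ∫ t, ∫ x, G (t, x) = ∫ t in Iio (0 : ℝ), ∫ x, G (t, x) := by
    refine (setIntegral_eq_integral_of_forall_compl_eq_zero fun t ht => ?_).symm
    have ht' : ∀ x, G (t, x) = 0 := fun x => h0 (t, x) fun h => ht (hQ (hsupp h)).1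
    simp [ht']
  rw [h1, h2, h3]

/-- **Fubini for the limit divergence identity**: the integral over `Q(N)` is the integral over
all of space–time. [folklore] -/
theorem setIntegral_inner_gradient_eq_integral {N : ℝ}
    (W : ℝ × EuclideanSpace ℝ (Fin 3) → EuclideanSpace ℝ (Fin 3))
    {θ : ℝ → EuclideanSpace ℝ (Fin 3) → ℝ} (hsupp : tsupport (uncurry θ) ⊆ parCyl 0 N) :
    ∫ z in parCyl 0 N, ⟪W z, gradient (θ z.1) z.2⟫ = ∫ z, ⟪W z, gradient (θ z.1) z.2⟫ :=
  setIntegral_eq_integral_of_forall_compl_eq_zero fun _ hz =>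
    inner_gradient_eq_zero_of_notMem W fun h => hz (hsupp h)

/-! ### Divergence-free slices of the limit -/

/-- **From the space–time divergence identity to divergence-free slices.** Let `W` be continuous
on the open half-space `{t < 0} × ℝ³` and bounded by `1` there, with `∫∫ ⟪W, ∇ₓΘ⟫ = 0` for every
scalar space–time test `Θ` on the slab. Then `W(t, ·)` is weakly divergence free for a.e.
`t < 0`: test with `Θ = η ⊗ θ`, `η ∈ C_c^∞(]-∞, 0[)`, use Fubini and the fundamental lemma of the
calculus of variations in `t` (Mathlib's `IsOpen.ae_eq_zero_of_integral_contDiff_smul_eq_zero`),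
then `ae_isWeaklyDivFree_of_forall_test`. [cite: KochNadirashviliSereginSverak2009, §4 (ii) ("div u = 0 in the sense of distributions")] -/
theorem ae_isWeaklyDivFree_of_forall_spaceTimeTest
    {W : ℝ × EuclideanSpace ℝ (Fin 3) → EuclideanSpace ℝ (Fin 3)}
    (hW : ContinuousOn W (Iio 0 ×ˢ univ))
    (hb : ∀ z ∈ Iio (0 : ℝ) ×ˢ (univ : Set (EuclideanSpace ℝ (Fin 3))), ‖W z‖ ≤ 1)
    (h : ∀ Θ : ℝ → EuclideanSpace ℝ (Fin 3) → ℝ,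
      IsSpaceTimeTestOn (slab (EuclideanSpace ℝ (Fin 3)) (Iio 0) isOpen_Iio) Θ →
        ∫ z, ⟪W z, gradient (Θ z.1) z.2⟫ = 0) :
    ∀ᵐ t ∂(volume.restrict (Iio (0 : ℝ))), IsWeaklyDivFree (fun x => W (t, x)) := by
  refine ae_isWeaklyDivFree_of_forall_test ?_ ?_
  · filter_upwards [ae_restrict_mem measurableSet_Iio] with t ht
    have hc : Continuous fun x => W (t, x) :=
      hW.comp_continuous (continuous_const.prodMk continuous_id) fun x => ⟨ht, mem_univ _⟩
    refine ⟨hc.aestronglyMeasurable, fun n => ?_⟩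
    have hle : ∀ x, ‖W (t, x)‖ₑ ^ 2 ≤ 1 := fun x => by
      have h1 : ‖W (t, x)‖ₑ ≤ 1 := by
        rw [← ofReal_norm]
        exact ENNReal.ofReal_le_one.2 (hb (t, x) ⟨ht, mem_univ _⟩)
      exact pow_le_one₀ bot_le h1
    calc ∫⁻ x in closedBall (0 : EuclideanSpace ℝ (Fin 3)) n, ‖W (t, x)‖ₑ ^ 2
        ≤ ∫⁻ _ in closedBall (0 : EuclideanSpace ℝ (Fin 3)) n, 1 := lintegral_mono fun x => hle x
      _ = volume (closedBall (0 : EuclideanSpace ℝ (Fin 3)) n) := by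
          rw [setLIntegral_const, one_mul]
      _ < ∞ := measure_closedBall_lt_top
  · intro θ hθ
    -- the slice pairing `g t = ∫ ⟪W(t), ∇θ⟫` and its joint integrand
    have hgc : Continuous (gradient θ) :=
      continuous_gradient_of_contDiff (contDiff_infty.1 hθ.contDiff 1)
    have hgK : HasCompactSupport (gradient θ) :=
      HasCompactSupport.intro hθ.hasCompactSupport fun x hx => gradient_eq_zero_of_notMem_tsupport hx
    have hgi : Integrable (gradient θ) := hgc.integrable_of_hasCompactSupport hgK
    set F : ℝ × EuclideanSpace ℝ (Fin 3) → ℝ := fun z => ⟪W z, gradient θ z.2⟫ with hF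
    have hFc : ContinuousOn F (Iio 0 ×ˢ univ) := hW.inner (hgc.comp continuous_snd).continuousOn
    -- integrability on the finite slabs `]a, 0[ × ℝ³`
    have hFa : ∀ a : ℝ, Integrable F (((volume : Measure ℝ).restrict (Ioo a 0)).prod
        (volume : Measure (EuclideanSpace ℝ (Fin 3)))) := by
      intro a
      haveI : IsFiniteMeasure ((volume : Measure ℝ).restrict (Ioo a 0)) :=
        isFiniteMeasure_restrict.2 measure_Ioo_lt_top.ne
      have hsub : Ioo a 0 ×ˢ (univ : Set (EuclideanSpace ℝ (Fin 3))) ⊆ Iio 0 ×ˢ univ :=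
        prod_mono Ioo_subset_Iio_self Subset.rfl
      have hm : AEStronglyMeasurable F (((volume : Measure ℝ).restrict (Ioo a 0)).prod
          (volume : Measure (EuclideanSpace ℝ (Fin 3)))) := by
        rw [Measure.restrict_prod_eq_prod_univ, ← Measure.volume_eq_prod]
        exact (hFc.mono hsub).aestronglyMeasurable (measurableSet_Ioo.prod MeasurableSet.univ)
      refine Integrable.mono' ((integrable_const (1 : ℝ)).mul_prod hgi.norm) hm ?_
      rw [Measure.restrict_prod_eq_prod_univ, ← Measure.volume_eq_prod]
      filter_upwards [ae_restrict_mem (measurableSet_Ioo.prod MeasurableSet.univ)] with z hz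
      exact (norm_inner_le_norm _ _).trans (mul_le_mul_of_nonneg_right (hb z (hsub hz))
        (norm_nonneg _))
    have hga : ∀ a : ℝ, IntegrableOn (fun t => ∫ x, F (t, x)) (Ioo a 0) volume := fun a =>
      (hFa a).integral_prod_left
    have hloc : LocallyIntegrableOn (fun t => ∫ x, F (t, x)) (Iio 0) volume := fun t ht =>
      ⟨Ioo (t - 1) 0, mem_nhdsWithin_of_mem_nhds (Ioo_mem_nhds (by linarith) ht), hga (t - 1)⟩
    -- the fundamental lemma in `t`
    have key := IsOpen.ae_eq_zero_of_integral_contDiff_smul_eq_zero isOpen_Iio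
      (μ := (volume : Measure ℝ)) (f := fun t => ∫ x, F (t, x)) hloc ?_
    · exact (ae_restrict_iff' measurableSet_Iio).2 key
    intro η hη hηc hηI
    obtain ⟨C, hC⟩ := hη.continuous.bounded_above_of_compact_support hηc
    have hC' : ∀ s, |η s| ≤ C := fun s => by simpa [Real.norm_eq_abs] using hC s
    -- time support of `η` inside some `]a, 0[`
    obtain ⟨a₀, ha₀⟩ := hηc.isCompact.bddBelow
    set a : ℝ := a₀ - 1 with ha
    have hηa : ∀ s, η s ≠ 0 → s ∈ Ioo a 0 := fun s hs => by
      have hs' : s ∈ tsupport η := subset_tsupport _ hs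
      exact ⟨by linarith [ha₀ hs'], hηI hs'⟩
    -- the tested identity with `Θ = η ⊗ θ`
    have hΘ : IsSpaceTimeTestOn (slab (EuclideanSpace ℝ (Fin 3)) (Iio 0) isOpen_Iio)
        (fun s x => η s • θ x) := isSpaceTimeTestOn_slab_smul isOpen_Iio hη hηc hηI hθ
    have h0 := h _ hΘ
    have hθd : Differentiable ℝ θ := hθ.contDiff.differentiable (by simp)
    have hgrad : ∀ s x, gradient (fun x => η s • θ x) x = η s • gradient θ x := by
      intro s x
      rw [gradient, gradient, show (fun x => η s • θ x) = fun x => η s * θ x from rfl,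
        fderiv_const_mul (hθd x), map_smul]
    simp_rw [hgrad, real_inner_smul_right] at h0
    -- `h0 : ∫ z, η z.1 * F z = 0`; Fubini on the slab `]a, 0[ × ℝ³`
    have hηF : Integrable (fun z : ℝ × EuclideanSpace ℝ (Fin 3) => η z.1 * F z)
        (((volume : Measure ℝ).restrict (Ioo a 0)).prod (volume : Measure (EuclideanSpace ℝ (Fin 3)))) :=
      integrable_time_mul (hFa a) hη.continuous hC'
    have hηF' : Integrable (fun z : ℝ × EuclideanSpace ℝ (Fin 3) => η z.1 * F z)
        (volume : Measure (ℝ × EuclideanSpace ℝ (Fin 3))) := by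
      have h1 : IntegrableOn (fun z : ℝ × EuclideanSpace ℝ (Fin 3) => η z.1 * F z)
          (Ioo a 0 ×ˢ univ) volume := by
        rw [IntegrableOn, Measure.volume_eq_prod, ← Measure.restrict_prod_eq_prod_univ]
        exact hηF
      refine h1.integrable_of_forall_notMem_eq_zero fun z hz => ?_
      have hz' : η z.1 = 0 := by
        by_contra hne
        exact hz ⟨hηa z.1 hne, mem_univ _⟩
      rw [hz', zero_mul]
    have h2 : ∫ z, η z.1 * F z = ∫ t, η t * ∫ x, F (t, x) := by
      rw [Measure.volume_eq_prod, integral_prod _ (by simpa [Measure.volume_eq_prod] using hηF')]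
      simp_rw [integral_const_mul]
    rw [h2] at h0
    simpa only [smul_eq_mul] using h0

end SereginSverak2009

end Literature.Analysis.FluidPDE
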